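import Summits.ResolutionOfSingularities.ResolutionOfSingularities.Theorems.WeightedInvariantLocalWeightedDropNCArrangementsNullity
import Summits.ResolutionOfSingularities.ResolutionOfSingularities.Theorems.WeightedInvariantLocalWeightedDropNCArrangementsCoordinates
import Summits.ResolutionOfSingularities.ResolutionOfSingularities.Theorems.WeightedInvariantLocalWeightedDropNCArrangementsForms

/-!
# `LocalWeightedDrop`, line `nc-game-transport`, rung R2 (hyperplane arrangements): THE MOVE of the arrangement game — chart,
# saturation, slice, and the drop of the nullity

[OURS · L1 W4.3 · chain w43, engine crux `LocalWeightedDrop` stmt-ResolutionOfSingularities-8899; strategist res-L1-w43-strat-1's line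
`nc-game-transport`, TOT rung R2 «hyperplane arrangements» (spec `L/res-L1-w43-strat-1/TOT-RUNGS-SPEC.md` §R2); res-type-088.]  Nothing
here is a statement of any manuscript; the count game (`TameFourTupleDrop.WinsIn`) is the programme's own.

An ADAPTED position: index sets `B` (the core) and `L` (the coloops), disjoint; coefficient vectors `α j ∈ k^{m+1}` supported on the
block `S = {i : i < r}` for `j ∈ B` and off `S` for `j ∈ L`; the move has weights `w = 𝟙_S` (centre = the flat `∩_{j ∈ B} ker ℓ_j`) and the
opponent answers with `c ≠ 0` supported on `S`.
* `subst_chart_prod` — the TRANSFORM: `(∏_{B ∪ L} ℓ_j)(chart_{w,c}) = s^{|B|} · G₀`, `G₀ = ∏_{B} (C (α j ⬝ᵥ c) + ℓ_j(y′)) · ∏_{L} ℓ_j(y′)`;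
  `not_X_dvd_G₀` — `s ∤ G₀` (so `(|B|, G₀)` IS the `s`-saturation).
* `X_mul_slice_G₀` — the NEW POSITION at a live slot `l`: `s · G₀|_{y′_l = 0} = U · ∏_{j ∈ s′} ℓ′_j` with `U` a unit (the forms of `B` not
  vanishing at `c`), `s′ = {j₀} ∪ B_c ∪ L` (`B_c` = the forms of `B` vanishing at `c`, `j₀ ∈ B ∖ B_c` re-used as the index of the new
  form `s = x₀`), new coefficient vectors `a′ j₀ = e₀`, `a′ j = restr l (α j)` otherwise — again an arrangement, all vectors non-zero
  (`newVec_ne_zero`).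
* `nullity_new_lt` — THE DROP: if the `B`-family is coloop-free in itself, `ν(a′, s′) < ν(α, B ∪ L)`: `ν` is additive over the blocks
  `{s} ⊕ (S ∖ l) ⊕ Sᶜ` (`nullity_union`, `disjoint_span_of_supports`), the slice is injective on `span (α '' B_c)` (all `⊥ c`, `c_l ≠ 0`)
  and on `span (α '' L)` (supported off `S ∋ l`) (`nullity_comp_eq`), and `ν(α, B_c) < ν(α, B)` (`nullity_lt_of_ssubset`).
-/

set_option linter.dupNamespace false -- mandated namespace of this single-conjunct summit

namespace Summit.ResolutionOfSingularities.ResolutionOfSingularities.Theorems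

namespace NCArrangement

open MvPowerSeries Matrix Module Submodule Literature.AlgebraicGeometry.Resolution

variable {k : Type} [Field k] {m : ℕ} {ι : Type} [DecidableEq ι]

/-- The indicator weights of the block `{i : i < r}`. -/
def blockWeight (m r : ℕ) : Fin (m + 1) → ℕ := fun i => if i.val < r then 1 else 0

omit [DecidableEq ι] in
/-- Unfolding the block weights. -/
theorem blockWeight_apply (r : ℕ) (i : Fin (m + 1)) : blockWeight m r i = if i.val < r then 1 else 0 := rfl

/-! ## The transform and its saturation -/

/-- `s ∤ linFormUp a` for `a ≠ 0`. -/
theorem not_X_dvd_linFormUp {a : Fin (m + 1) → k} (ha : a ≠ 0) : ¬ X (0 : Fin (m + 1 + 1)) ∣ linFormUp a := by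
  have := not_X_dvd_C_add_linFormUp (0 : k) ha
  rwa [map_zero, zero_add] at this

/-- THE TRANSFORM OF AN ADAPTED PRODUCT OF FORMS under `chart_{𝟙_S, c}`. -/
theorem subst_chart_prod {r : ℕ} {c : Fin (m + 1) → k} (hc : ∀ i, blockWeight m r i = 0 → c i = 0)
    {α : ι → Fin (m + 1) → k} {B L : Finset ι} (hBL : Disjoint B L)
    (hB : ∀ j ∈ B, ∀ i : Fin (m + 1), r ≤ i.val → α j i = 0) (hL : ∀ j ∈ L, ∀ i : Fin (m + 1), i.val < r → α j i = 0) :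
    subst (CobordantChart.chart (blockWeight m r) c) (∏ j ∈ B ∪ L, linForm (α j)) =
      X 0 ^ B.card * ((∏ j ∈ B, (C (α j ⬝ᵥ c) + linFormUp (α j))) * ∏ j ∈ L, linFormUp (α j)) := by
  have hch := CobordantChart.hasSubst_chart (blockWeight m r) c hc
  rw [← coe_substAlgHom hch, map_prod, Finset.prod_union hBL]
  have hBj : ∀ j ∈ B, substAlgHom hch (linForm (α j)) = X 0 * (C (α j ⬝ᵥ c) + linFormUp (α j)) := by
    intro j hj
    rw [coe_substAlgHom]
    refine subst_chart_linForm_on hc fun i hi => ?_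
    rw [blockWeight_apply]
    by_cases h : i.val < r
    · rw [if_pos h]
    · exact absurd (hB j hj i (by omega)) hi
  have hLj : ∀ j ∈ L, substAlgHom hch (linForm (α j)) = linFormUp (α j) := by
    intro j hj
    rw [coe_substAlgHom]
    refine subst_chart_linForm_off hc fun i hi => ?_
    rw [blockWeight_apply]
    by_cases h : i.val < r
    · exact absurd (hL j hj i h) hi
    · rw [if_neg h]
  rw [Finset.prod_congr rfl hBj, Finset.prod_congr rfl hLj, Finset.prod_mul_distrib, Finset.prod_const]
  ring

/-- `s ∤ G₀`. -/
theorem not_X_dvd_G₀ (c : Fin (m + 1) → k) {α : ι → Fin (m + 1) → k} {B L : Finset ι}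
    (hα : ∀ j ∈ B ∪ L, α j ≠ 0) :
    ¬ X (0 : Fin (m + 1 + 1)) ∣ (∏ j ∈ B, (C (α j ⬝ᵥ c) + linFormUp (α j))) * ∏ j ∈ L, linFormUp (α j) := by
  have hp := MvPowerSeries.prime_X' k (0 : Fin (m + 1 + 1))
  intro h
  rcases hp.dvd_or_dvd h with h | h
  · obtain ⟨j, hj, hdvd⟩ := hp.exists_mem_finset_dvd h
    exact not_X_dvd_C_add_linFormUp _ (hα j (Finset.mem_union_left _ hj)) hdvd
  · obtain ⟨j, hj, hdvd⟩ := hp.exists_mem_finset_dvd h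
    exact not_X_dvd_linFormUp (hα j (Finset.mem_union_right _ hj)) hdvd

omit [DecidableEq ι] in
/-- The bracket factors of `B` contribute the unit `∏ (α j ⬝ᵥ c)` over the forms NOT vanishing at `c`. -/
theorem constantCoeff_unitPart (c : Fin (m + 1) → k) (l : Fin (m + 1)) {α : ι → Fin (m + 1) → k} (Bu : Finset ι)
    (hBu : ∀ j ∈ Bu, α j ⬝ᵥ c ≠ 0) :
    constantCoeff (∏ j ∈ Bu, (C (α j ⬝ᵥ c) + linForm (restr l (α j)))) ≠ 0 := by
  rw [map_prod]
  refine Finset.prod_ne_zero_iff.mpr fun j hj => ?_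
  have : constantCoeff (C (α j ⬝ᵥ c) + linForm (restr l (α j))) = α j ⬝ᵥ c := by
    unfold linForm
    rw [map_add, constantCoeff_C, map_sum, Finset.sum_eq_zero (fun i _ => by
      rw [smul_eq_C_mul, map_mul, constantCoeff_X, mul_zero]), add_zero]
  rw [this]
  exact hBu j hj

/-! ## The new position at a live slot -/

/-- THE NEW POSITION: `s · G₀|_{y′_l = 0}` is a unit times the product of the forms of the new arrangement
`{e₀} ∪ restr_l(α '' B_c) ∪ restr_l(α '' L)`, indexed by `insert j₀ (B_c ∪ L)` with `j₀ ∈ B ∖ B_c` re-used for `e₀`. -/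
theorem X_mul_slice_G₀ [DecidableEq k] (c : Fin (m + 1) → k) (l : Fin (m + 1)) {α : ι → Fin (m + 1) → k} {B L : Finset ι}
    (hBL : Disjoint B L) {j₀ : ι} (hj₀ : j₀ ∈ B) (hj₀c : α j₀ ⬝ᵥ c ≠ 0) :
    X 0 * TupleGame.slice l ((∏ j ∈ B, (C (α j ⬝ᵥ c) + linFormUp (α j))) * ∏ j ∈ L, linFormUp (α j)) =
      (∏ j ∈ B.filter (fun j => α j ⬝ᵥ c ≠ 0), (C (α j ⬝ᵥ c) + linForm (restr l (α j)))) *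
        ∏ j ∈ insert j₀ (B.filter (fun j => α j ⬝ᵥ c = 0) ∪ L),
          linForm (Function.update (fun j => restr l (α j)) j₀ (Pi.single 0 1) j) := by
  -- slice the bracket
  rw [TupleMonomialPhase.slice_mul, slice_finset_prod, slice_finset_prod]
  simp_rw [slice_C_add_linFormUp, slice_linFormUp]
  -- split `B` by vanishing at `c`
  rw [← Finset.prod_filter_mul_prod_filter_not B (fun j => α j ⬝ᵥ c ≠ 0)]
  have hBc : ∀ j ∈ B.filter (fun j => ¬ α j ⬝ᵥ c ≠ 0), C (α j ⬝ᵥ c) + linForm (restr l (α j)) = linForm (restr l (α j)) := by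
    intro j hj
    have h0 : α j ⬝ᵥ c = 0 := not_not.mp (Finset.mem_filter.mp hj).2
    rw [h0, map_zero, zero_add]
  rw [Finset.prod_congr rfl hBc]
  have hfilt : B.filter (fun j => ¬ α j ⬝ᵥ c ≠ 0) = B.filter (fun j => α j ⬝ᵥ c = 0) :=
    Finset.filter_congr fun j _ => not_not
  rw [hfilt]
  -- the new product
  have hj₀not : j₀ ∉ B.filter (fun j => α j ⬝ᵥ c = 0) ∪ L := by
    rw [Finset.mem_union, Finset.mem_filter, not_or]
    exact ⟨fun h => hj₀c h.2, Finset.disjoint_left.mp hBL hj₀⟩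
  rw [Finset.prod_insert hj₀not, Function.update_self, linForm_single]
  have hrest : ∀ j ∈ B.filter (fun j => α j ⬝ᵥ c = 0) ∪ L,
      linForm (Function.update (fun j => restr l (α j)) j₀ (Pi.single 0 1) j) = linForm (restr l (α j)) := by
    intro j hj
    rw [Function.update_of_ne (fun h : j = j₀ => hj₀not (h ▸ hj))]
  rw [Finset.prod_congr rfl hrest,
    Finset.prod_union (Finset.disjoint_of_subset_left (Finset.filter_subset _ _) hBL)]
  ring

/-- THE NEW VECTORS ARE NON-ZERO (at a live slot `l < r` with `c_l ≠ 0`). -/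
theorem newVec_ne_zero [DecidableEq k] {r : ℕ} {c : Fin (m + 1) → k} {l : Fin (m + 1)} (hl : l.val < r) (hcl : c l ≠ 0)
    {α : ι → Fin (m + 1) → k} {B L : Finset ι}
    (hL : ∀ j ∈ L, ∀ i : Fin (m + 1), i.val < r → α j i = 0) (hα : ∀ j ∈ B ∪ L, α j ≠ 0) (j₀ : ι) :
    ∀ j ∈ insert j₀ (B.filter (fun j => α j ⬝ᵥ c = 0) ∪ L),
      Function.update (fun j => restr l (α j)) j₀ (Pi.single (0 : Fin (m + 1)) (1 : k)) j ≠ 0 := by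
  intro j hj
  by_cases hjj : j = j₀
  · subst hjj
    rw [Function.update_self]
    intro h
    have := congr_fun h 0
    rw [Pi.single_eq_same, Pi.zero_apply] at this
    exact one_ne_zero this
  rw [Function.update_of_ne hjj]
  intro h
  have hrest : ∀ i, i ≠ l → α j i = 0 := fun i hi => eq_zero_of_restr_eq_zero h hi
  rcases Finset.mem_insert.mp hj with hj | hj
  · exact hjj hj
  rcases Finset.mem_union.mp hj with hjB | hjL
  · obtain ⟨hjB, hjc⟩ := Finset.mem_filter.mp hjB
    rw [dotProduct_eq_of_support_single hrest c] at hjc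
    rcases mul_eq_zero.mp hjc with h1 | h1
    · exact hα j (Finset.mem_union_left _ hjB) (funext fun i => by
        by_cases hi : i = l
        · rw [hi]; exact h1
        · exact hrest i hi)
    · exact hcl h1
  · exact hα j (Finset.mem_union_right _ hjL) (funext fun i => by
      by_cases hi : i = l
      · rw [hi]; exact hL j hjL l hl
      · exact hrest i hi)

/-! ## The drop of the nullity -/

/-- The slice is injective on vectors orthogonal to `c` when `c_l ≠ 0`. -/
theorem restr_injOn_orth {c : Fin (m + 1) → k} {l : Fin (m + 1)} (hcl : c l ≠ 0) {v : Fin (m + 1) → k}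
    (hv : v ⬝ᵥ c = 0) (h : restr l v = 0) : v = 0 := by
  have hrest : ∀ i, i ≠ l → v i = 0 := fun i hi => eq_zero_of_restr_eq_zero h hi
  rw [dotProduct_eq_of_support_single hrest c] at hv
  rcases mul_eq_zero.mp hv with h1 | h1
  · funext i
    by_cases hi : i = l
    · rw [hi]; exact h1
    · exact hrest i hi
  · exact absurd h1 hcl

omit [DecidableEq ι] in
/-- Vectors orthogonal to `c` form a subspace containing the span of orthogonal generators. -/
theorem dotProduct_eq_zero_of_mem_span {c : Fin (m + 1) → k} {α : ι → Fin (m + 1) → k} {T : Finset ι}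
    (hT : ∀ j ∈ T, α j ⬝ᵥ c = 0) {v : Fin (m + 1) → k} (hv : v ∈ span k (α '' (↑T : Set ι))) : v ⬝ᵥ c = 0 := by
  induction hv using Submodule.span_induction with
  | mem x hx =>
    obtain ⟨j, hj, rfl⟩ := hx
    exact hT j hj
  | zero => exact zero_dotProduct c
  | add x y _ _ hx hy => rw [add_dotProduct, hx, hy, add_zero]
  | smul r x _ hx => rw [smul_dotProduct, hx, smul_zero]

/-- THE DROP OF THE NULLITY under the move (the `B`-family coloop-free in itself, the answer `c` at a live slot `l < r`). -/
theorem nullity_new_lt [DecidableEq k] {r : ℕ} {c : Fin (m + 1) → k} {l : Fin (m + 1)} (hl : l.val < r) (hcl : c l ≠ 0)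
    {α : ι → Fin (m + 1) → k} {B L : Finset ι} (hBL : Disjoint B L)
    (hB : ∀ j ∈ B, ∀ i : Fin (m + 1), r ≤ i.val → α j i = 0) (hL : ∀ j ∈ L, ∀ i : Fin (m + 1), i.val < r → α j i = 0)
    (hBfree : ∀ j ∈ B, α j ∈ span k (α '' (↑(B.erase j) : Set ι)))
    {j₀ : ι} (hj₀ : j₀ ∈ B) (hj₀c : α j₀ ⬝ᵥ c ≠ 0) :
    nullity k (Function.update (fun j => restr l (α j)) j₀ (Pi.single (0 : Fin (m + 1)) (1 : k)))
        (insert j₀ (B.filter (fun j => α j ⬝ᵥ c = 0) ∪ L)) <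
      nullity k α (B ∪ L) := by
  set Bc := B.filter (fun j => α j ⬝ᵥ c = 0) with hBc
  set a' := Function.update (fun j => restr l (α j)) j₀ (Pi.single (0 : Fin (m + 1)) (1 : k)) with ha'
  have hBcB : Bc ⊆ B := Finset.filter_subset _ _
  have hj₀Bc : j₀ ∉ Bc := fun h => hj₀c (Finset.mem_filter.mp h).2
  have hj₀L : j₀ ∉ L := Finset.disjoint_left.mp hBL hj₀
  have hBcL : Disjoint Bc L := Finset.disjoint_of_subset_left hBcB hBL
  have ha'ne : ∀ j, j ≠ j₀ → a' j = restr l (α j) := fun j hj => by rw [ha', Function.update_of_ne hj]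
  -- the old side
  have hold : nullity k α (B ∪ L) = nullity k α B + nullity k α L :=
    nullity_union hBL (disjoint_span_of_supports (fun i => i.val < r) (fun i => r ≤ i.val)
      (fun j hj i hi => hB j hj i (by omega)) (fun j hj i hi => hL j hj i (by omega)) (fun i h => by omega))
  -- the new side: `{j₀} ⊕ (Bc ∪ L)`
  have hnew1 : nullity k a' (insert j₀ (Bc ∪ L)) = nullity k a' {j₀} + nullity k a' (Bc ∪ L) := by
    rw [Finset.insert_eq]
    refine nullity_union (Finset.disjoint_singleton_left.mpr (by
      rw [Finset.mem_union, not_or]; exact ⟨hj₀Bc, hj₀L⟩)) ?_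
    refine disjoint_span_of_supports (fun i => i = 0) (fun i => i ≠ 0) ?_ ?_ (fun i h => h.2 h.1)
    · intro j hj i hi
      rw [Finset.mem_singleton] at hj
      rw [hj, ha', Function.update_self, Pi.single_eq_of_ne hi]
    · intro j hj i hi
      have hjne : j ≠ j₀ := by
        rintro rfl
        rw [Finset.mem_union] at hj
        exact hj.elim hj₀Bc hj₀L
      rw [ha'ne j hjne, not_not.mp hi, restr_zero]
  have hnew0 : nullity k a' {j₀} = 0 := by
    have h := nullity_add_finrank (k := k) a' {j₀}
    rw [Finset.coe_singleton, Set.image_singleton, Finset.card_singleton] at h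
    have h1 : finrank k (span k ({a' j₀} : Set (Fin (m + 1) → k))) = 1 := by
      refine finrank_span_singleton ?_
      rw [ha', Function.update_self]
      intro h0
      have := congr_fun h0 0
      rw [Pi.single_eq_same, Pi.zero_apply] at this
      exact one_ne_zero this
    omega
  -- `(Bc ∪ L)` splits along the blocks of the sliced coordinates
  have hnew2 : nullity k a' (Bc ∪ L) = nullity k a' Bc + nullity k a' L := by
    refine nullity_union hBcL (disjoint_span_of_supports
      (fun i => ∃ q : Fin m, i = q.succ ∧ (l.succAbove q).val < r)
      (fun i => ∃ q : Fin m, i = q.succ ∧ r ≤ (l.succAbove q).val) ?_ ?_ ?_)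
    · intro j hj i hi
      have hjne : j ≠ j₀ := fun h : j = j₀ => hj₀Bc (h ▸ hj)
      rw [ha'ne j hjne]
      revert hi
      refine Fin.cases ?_ (fun q => ?_) i
      · intro _; exact restr_zero l _
      · intro hq
        rw [restr_succ]
        exact hB j (hBcB hj) _ (by by_contra h'; exact hq ⟨q, rfl, by omega⟩)
    · intro j hj i hi
      have hjne : j ≠ j₀ := fun h : j = j₀ => hj₀L (h ▸ hj)
      rw [ha'ne j hjne]
      revert hi
      refine Fin.cases ?_ (fun q => ?_) i
      · intro _; exact restr_zero l _
      · intro hq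
        rw [restr_succ]
        exact hL j hj _ (by by_contra h'; exact hq ⟨q, rfl, by omega⟩)
    · rintro i ⟨⟨q, rfl, hq⟩, ⟨q', hqq', hq'⟩⟩
      rw [Fin.succ_inj] at hqq'
      subst hqq'
      omega
  -- the slice does not change the nullity of `Bc` and of `L`
  have hnewBc : nullity k a' Bc = nullity k α Bc := by
    rw [nullity_congr (fun j hj => ha'ne j (fun h : j = j₀ => hj₀Bc (h ▸ hj)))]
    have := nullity_comp_eq (k := k) (restrLin (k := k) l) (a := α) (s := Bc) fun v hv h0 =>
      restr_injOn_orth hcl (dotProduct_eq_zero_of_mem_span (fun j hj => (Finset.mem_filter.mp hj).2) hv) h0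
    simpa only [restrLin_apply] using this
  have hnewL : nullity k a' L = nullity k α L := by
    rw [nullity_congr (fun j hj => ha'ne j (fun h : j = j₀ => hj₀L (h ▸ hj)))]
    have := nullity_comp_eq (k := k) (restrLin (k := k) l) (a := α) (s := L) fun v hv h0 => by
      -- `v` is supported off the block, in particular `v l = 0`
      have hvl : v l = 0 := by
        have hle : span k (α '' (↑L : Set ι)) ≤ suppSub k (m + 1) (fun i => r ≤ i.val) :=
          Submodule.span_le.mpr (by rintro _ ⟨j, hj, rfl⟩; exact fun i hi => hL j hj i (by omega))
        exact hle hv l (by omega)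
      funext i
      by_cases hi : i = l
      · rw [hi]; exact hvl
      · exact eq_zero_of_restr_eq_zero h0 hi
    simpa only [restrLin_apply] using this
  -- the core loses a form
  have hdrop : nullity k α Bc < nullity k α B :=
    nullity_lt_of_ssubset hBfree (Finset.ssubset_iff_subset_ne.mpr ⟨hBcB, fun h : Bc = B => hj₀Bc (h ▸ hj₀)⟩)
  rw [hnew1, hnew0, hnew2, hnewBc, hnewL, hold]
  omega

end NCArrangement

end Summit.ResolutionOfSingularities.ResolutionOfSingularities.Theorems
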